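import Mathlib.MeasureTheory.Integral.IntervalIntegral.FundThmCalculus
import Summits.AnomalousDissipation.AnomalousDissipation.Theorems.MarginalStabilityChainChainRealisationStubH2NonlinearEstimate
import Literature.Analysis.FluidPDE.TorusClassicalHnBalance
import Literature.Analysis.FunctionSpaces.TorusClassicalNSGluing
import HarnessLib

/-!
# Stub `stub_windowP3` of the line `SketchIdeator2` (card `separatrix-flux-pinning`)
# (crux `MarginalStabilityChain.ChainRealisation`, stmt-AnomalousDissipation-14249)

Sorry-free discharge of the registered stub `stub_windowP3` (P2) of the lead's skeleton: the
**sliding-window bound on the third-order pure energies** of a forward classical Navier–Stokes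
solution on `[0, ∞) × T³` with steady smooth force `F`, mean-zero slices, enstrophy bound
`‖∇u(t)‖₂² ≤ M` (`t ≥ 0`) and `H²` bound `‖Δu(t)‖₂² ≤ M₂` (`t ≥ 1`):
`∫ₜ^{t+1} Σᵢ ‖∂ᵢ³u(s)‖₂² ds ≤ C` for every `t ≥ 1` — the base input of the Sobolev ladder of the
fixed-`ν` forward-phase construction (Foias–Manley–Rosa–Temam 2001, Ch. II App. A §A.4–A.5;
Constantin–Foias 1988, Ch. 13).

Paper proof.  Restrict the solution to `[t, t+1] ⊆ [0, ∞)` (`IsClassicalNSSolutionOn.mono`).  The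
`H²` balance (the tree's even-order balance
`IsClassicalNSSolutionOn.hasDerivWithinAt_half_integral_norm_sq_laplacian_iterate` with `n = 1`) reads
`E' = −ν L − I` with `E(s) = ½‖Δu(s)‖₂²`, `L(s) = ‖∇Δu(s)‖₂² = gradNormSq (Δu(s))`,
`I(s) = ∫ ⟪(u·∇)u − F, Δ²u⟫`.  The landed `H²` nonlinear estimate `stub_h2NonlinearEstimate` gives
`|∫⟪(u·∇)u, Δ²u⟫| ≤ (ν/2) L + C₀ (1 + ‖Δu‖₂²)² ≤ (ν/2) L + C₁ (1 + M₂)²` (`C₁ = max C₀ 0`, `s ≥ 1`),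
and Green's second identity with Cauchy–Schwarz/Young gives
`∫⟪F, Δ²u⟫ = ∫⟪ΔF, Δu⟫ ≤ ½(‖ΔF‖₂² + ‖Δu‖₂²) ≤ ½(‖ΔF‖₂² + M₂)`, so `−I ≤ (ν/2) L + b` on `[t, t+1]`.
`L` and `I` are continuous in time (space integrals of jointly smooth integrands,
`IsSmoothSpaceTimeOn.continuousOn_integral`), so the fundamental theorem of calculus on `[t, t+1]`
gives `ν ∫ₜ^{t+1} L = E(t) − E(t+1) − ∫ₜ^{t+1} I ≤ M₂/2 + (ν/2)∫ₜ^{t+1} L + b`, i.e.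
`∫ₜ^{t+1} L ≤ (2/ν)(M₂/2 + b)`.  Finally, pointwise in `s`,
`Σⱼ ‖∂ⱼ³u‖₂² ≤ Σⱼ Σᵢ Σₗ ‖∂ᵢ∂ₗ∂ⱼu‖₂² = Σⱼ ‖Δ∂ⱼu‖₂² = Σⱼ ‖∂ⱼΔu‖₂² = ‖∇Δu‖₂²`
(diagonal terms of a sum of squares; `h2NL_sum_sum_integral_eq` = two integrations by parts;
`Torus.partialDeriv_laplacian_comm`), and the window integral is monotone (both integrands are
continuous in `s`; the joint smoothness of `s ↦ ∂ᵢ³u(s) = ∂ᵢ∂ᵢ∂ᵢu(s)` is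
`IsSmoothSpaceTimeOn.partialDeriv`, thrice).
-/

set_option linter.dupNamespace false

noncomputable section

open MeasureTheory Set Filter Topology
open scoped InnerProductSpace
open Literature.Analysis.FunctionSpaces Literature.Analysis.FunctionSpaces.Torus
open Literature.Analysis.FluidPDE Literature.Analysis.FluidPDE.Torus

namespace Summit.AnomalousDissipation.AnomalousDissipation.Theorems.ChainRealisation.SeparatrixFluxPinning

/-- Local notation: the torus `T³`. -/
local notation "𝕋³" => UnitAddTorus (Fin 3)
/-- Local notation: velocity values. -/
local notation "E³" => EuclideanSpace ℝ (Fin 3)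

/-- **The third pure energies are dominated by `‖∇Δu‖₂²`**: for smooth `u : T³ → ℝ³`,
`Σⱼ ∫‖∂ⱼ³u‖² ≤ gradNormSq (Δu)`.  Indeed `gradNormSq (Δu) = Σⱼ ∫‖∂ⱼΔu‖²`
(`h2NL_sum_integral_eq_gradNormSq`), `∂ⱼΔu = Δ∂ⱼu` (`Torus.partialDeriv_laplacian_comm`),
`∫‖Δ∂ⱼu‖² = Σᵢ Σₗ ∫‖∂ᵢ∂ₗ∂ⱼu‖²` (`h2NL_sum_sum_integral_eq`, two integrations by parts), and the
diagonal term `i = l = j` of this sum of nonnegative terms is `∫‖∂ⱼ³u‖²`. -/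
theorem windowP3_sum_integral_iterate_three_le {u : 𝕋³ → E³} (hu : IsSmooth u) :
    ∑ j, ∫ x, ‖((partialDeriv j)^[3] u) x‖ ^ 2 ≤ gradNormSq (laplacian u) := by
  rw [← h2NL_sum_integral_eq_gradNormSq hu.laplacian]
  refine Finset.sum_le_sum fun j _ => ?_
  have e1 : partialDeriv j (laplacian u) = laplacian (partialDeriv j u) :=
    funext (partialDeriv_laplacian_comm hu j)
  have e3 : (partialDeriv j)^[3] u = partialDeriv j (partialDeriv j (partialDeriv j u)) := rfl
  rw [e1, ← h2NL_sum_sum_integral_eq (hu.partialDeriv j), e3]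
  have h0 : ∀ i l, 0 ≤ ∫ y, ‖partialDeriv i (partialDeriv l (partialDeriv j u)) y‖ ^ 2 :=
    fun i l => integral_nonneg fun _ => sq_nonneg _
  calc ∫ x, ‖partialDeriv j (partialDeriv j (partialDeriv j u)) x‖ ^ 2
      ≤ ∑ l, ∫ y, ‖partialDeriv j (partialDeriv l (partialDeriv j u)) y‖ ^ 2 :=
        Finset.single_le_sum
          (f := fun l => ∫ y, ‖partialDeriv j (partialDeriv l (partialDeriv j u)) y‖ ^ 2)
          (fun l _ => h0 j l) (Finset.mem_univ j)
    _ ≤ ∑ i, ∑ l, ∫ y, ‖partialDeriv i (partialDeriv l (partialDeriv j u)) y‖ ^ 2 :=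
        Finset.single_le_sum
          (f := fun i => ∑ l, ∫ y, ‖partialDeriv i (partialDeriv l (partialDeriv j u)) y‖ ^ 2)
          (fun i _ => Finset.sum_nonneg fun l _ => h0 i l) (Finset.mem_univ j)

/-- The force term of the `H²` balance: `∫ ⟪F, Δ²v⟫ = ∫ ⟪ΔF, Δv⟫ ≤ ½‖ΔF‖₂² + ½‖Δv‖₂²` for smooth
`F`, `v` on `T³` (Green's second identity `Torus.integral_inner_laplacian_comm`, then pointwise
`⟪a, b⟫ ≤ ‖a‖‖b‖ ≤ ½(‖a‖² + ‖b‖²)` and integrate). -/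
theorem windowP3_integral_inner_laplacian_laplacian_le {F v : 𝕋³ → E³} (hF : IsSmooth F)
    (hv : IsSmooth v) :
    ∫ x, ⟪F x, laplacian (laplacian v) x⟫_ℝ ≤
      2⁻¹ * (∫ x, ‖laplacian F x‖ ^ 2) + 2⁻¹ * ∫ x, ‖laplacian v x‖ ^ 2 := by
  have hΔF : IsSmooth (laplacian F) := hF.laplacian
  have hΔv : IsSmooth (laplacian v) := hv.laplacian
  rw [← integral_inner_laplacian_comm hF hΔv]
  have i1 : Integrable (fun x => 2⁻¹ * ‖laplacian F x‖ ^ 2) volume :=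
    hΔF.norm_sq.integrable.const_mul _
  have i2 : Integrable (fun x => 2⁻¹ * ‖laplacian v x‖ ^ 2) volume :=
    hΔv.norm_sq.integrable.const_mul _
  rw [← integral_const_mul, ← integral_const_mul, ← integral_add i1 i2]
  refine integral_mono (hΔF.inner hΔv).integrable (i1.add i2) fun x => ?_
  calc ⟪laplacian F x, laplacian v x⟫_ℝ ≤ ‖laplacian F x‖ * ‖laplacian v x‖ := real_inner_le_norm _ _
    _ ≤ 2⁻¹ * ‖laplacian F x‖ ^ 2 + 2⁻¹ * ‖laplacian v x‖ ^ 2 := by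
        nlinarith [sq_nonneg (‖laplacian F x‖ - ‖laplacian v x‖)]

/-- The real-analysis core (FMRT 2001, Ch. II App. A): if `E' = −ν L − I` on `[t, t+1]`
(one-sided derivative within the interval), `L`, `I` are integrable on `[t, t+1]`,
`−I ≤ (ν/2) L + b` there, `0 ≤ E(t+1)` and `E(t) ≤ m`, then `∫ₜ^{t+1} L ≤ (2/ν)(m + b)`
(fundamental theorem of calculus and monotonicity of the integral). -/
theorem windowP3_integral_le_of_balance {t ν b m : ℝ} {E L I : ℝ → ℝ} (hν : 0 < ν)
    (hderiv : ∀ s ∈ Icc t (t + 1), HasDerivWithinAt E (-ν * L s - I s) (Icc t (t + 1)) s)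
    (hLi : IntervalIntegrable L volume t (t + 1)) (hIi : IntervalIntegrable I volume t (t + 1))
    (hI : ∀ s ∈ Icc t (t + 1), -I s ≤ ν / 2 * L s + b) (hE1 : 0 ≤ E (t + 1))
    (hEt : E t ≤ m) : ∫ s in t..t + 1, L s ≤ 2 / ν * (m + b) := by
  have ht1 : t ≤ t + 1 := (lt_add_one t).le
  have hFTC : ∫ s in t..t + 1, (-ν * L s - I s) = E (t + 1) - E t :=
    intervalIntegral.integral_eq_sub_of_hasDerivAt_of_le ht1
      (fun s hs => (hderiv s hs).continuousWithinAt)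
      (fun s hs => (hderiv s (Ioo_subset_Icc_self hs)).hasDerivAt (Icc_mem_nhds hs.1 hs.2))
      ((hLi.const_mul (-ν)).sub hIi)
  rw [intervalIntegral.integral_sub (hLi.const_mul (-ν)) hIi,
    intervalIntegral.integral_const_mul] at hFTC
  have hIint : ∫ s in t..t + 1, -I s ≤ ∫ s in t..t + 1, (ν / 2 * L s + b) :=
    intervalIntegral.integral_mono_on ht1 hIi.neg ((hLi.const_mul _).add intervalIntegrable_const)
      hI
  rw [intervalIntegral.integral_neg,
    intervalIntegral.integral_add (hLi.const_mul _) intervalIntegrable_const,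
    intervalIntegral.integral_const_mul, intervalIntegral.integral_const, add_sub_cancel_left,
    one_smul] at hIint
  rw [div_mul_eq_mul_div, le_div_iff₀ hν]
  linarith

/-- **Stub `stub_windowP3` (P2 of the line `SketchIdeator2`): the sliding-window bound on the
third pure energies.**  A forward classical solution `u` of the Navier–Stokes system on
`[0, ∞) × T³` with viscosity `ν > 0`, steady smooth force `F`, mean-zero slices,
`‖∇u(t)‖₂² ≤ M` (`t ≥ 0`) and `‖Δu(t)‖₂² ≤ M₂` (`t ≥ 1`) has
`∫ₜ^{t+1} Σᵢ ∫‖∂ᵢ³u(s)‖² ds ≤ C` for all `t ≥ 1`, with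
`C = (2/ν)(M₂/2 + C₁(1 + M₂)² + ½‖ΔF‖₂² + ½M₂)`, `C₁ = max C₀ 0`, `C₀ = C₀(ν, M)` the constant of
the landed `H²` nonlinear estimate `stub_h2NonlinearEstimate` (Foias–Manley–Rosa–Temam 2001,
Ch. II App. A §A.4; Constantin–Foias 1988, Ch. 13: the `H²` balance
`hasDerivWithinAt_half_integral_norm_sq_laplacian_iterate` (`n = 1`) on `[t, t+1]`, the nonlinear
estimate, Green + Young for the force term, the fundamental theorem of calculus, and
`Σᵢ‖∂ᵢ³u‖₂² ≤ ‖∇Δu‖₂²`). -/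
theorem stub_windowP3 :
    ∀ (ν M M₂ : ℝ) (F : 𝕋³ → E³) (u : ℝ → 𝕋³ → E³) (p : ℝ → 𝕋³ → ℝ),
      0 < ν → IsSmooth F → IsClassicalNSSolutionOn (Set.Ici 0) ν (fun _ => F) u p →
      (∀ t : ℝ, 0 ≤ t → HasZeroMean (u t)) →
      (∀ t : ℝ, 0 ≤ t → gradNormSq (u t) ≤ M) →
      (∀ t : ℝ, 1 ≤ t → ∫ x, ‖laplacian (u t) x‖ ^ 2 ≤ M₂) →
      ∃ C : ℝ, ∀ t : ℝ, 1 ≤ t →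
        ∫ s in t..t + 1, (∑ i : Fin 3, ∫ x, ‖((partialDeriv i)^[3] (u s)) x‖ ^ 2) ≤ C := by
  intro ν M M₂ F u p hν hF h hzm hM hM₂
  have hM0 : 0 ≤ M := (gradNormSq_nonneg _).trans (hM 0 le_rfl)
  obtain ⟨C₀, hC₀⟩ := stub_h2NonlinearEstimate ν M hν hM0
  refine ⟨2 / ν * (M₂ / 2 + (max C₀ 0 * (1 + M₂) ^ 2 + 2⁻¹ * (∫ x, ‖laplacian F x‖ ^ 2) +
    2⁻¹ * M₂)), fun t ht => ?_⟩
  have ht1 : t < t + 1 := lt_add_one t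
  have ht0 : (0 : ℝ) ≤ t := zero_le_one.trans ht
  have hS : Icc t (t + 1) ⊆ Ici (0 : ℝ) := fun s hs => mem_Ici.2 (ht0.trans hs.1)
  have hU : UniqueDiffOn ℝ (Ici (0 : ℝ)) := uniqueDiffOn_Ici 0
  have hSc : Convex ℝ (Ici (0 : ℝ)) := convex_Ici 0
  have hu : IsSmoothSpaceTimeOn (Ici (0 : ℝ)) u := h.smooth_velocity
  have hΔst : IsSmoothSpaceTimeOn (Ici (0 : ℝ)) (fun s => laplacian (u s)) := hu.laplacian hU
  -- time continuity of `L(s) = gradNormSq (Δu(s))`, of `I(s) = ∫ ⟪(u·∇)u − F, Δ²u⟫` and of the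
  -- third pure energies
  have hLj : ∀ j : Fin 3, IsSmoothSpaceTimeOn (Ici (0 : ℝ))
      (fun s x => ‖partialDeriv j (laplacian (u s)) x‖ ^ 2) :=
    fun j => ContDiffOn.norm_sq ℝ (hΔst.partialDeriv hU j)
  have hLst : IsSmoothSpaceTimeOn (Ici (0 : ℝ))
      (fun s x => ∑ j, ‖partialDeriv j (laplacian (u s)) x‖ ^ 2) :=
    IsSmoothSpaceTimeOn.sum (w := fun (j : Fin 3) s x => ‖partialDeriv j (laplacian (u s)) x‖ ^ 2)
      fun j _ => hLj j
  have hLc : ContinuousOn (fun s => gradNormSq (laplacian (u s))) (Ici (0 : ℝ)) :=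
    hLst.continuousOn_integral hSc
  have hIc : ContinuousOn
      (fun s => ∫ x, ⟪convect (u s) (u s) x - F x, laplacian (laplacian (u s)) x⟫_ℝ) (Ici (0 : ℝ)) :=
    (((hu.convect hu hU).sub (isSmoothSpaceTimeOn_const hF _)).inner
      (hΔst.laplacian hU)).continuousOn_integral hSc
  have hPj : ∀ i : Fin 3, IsSmoothSpaceTimeOn (Ici (0 : ℝ))
      (fun s x => ‖((partialDeriv i)^[3] (u s)) x‖ ^ 2) :=
    fun i => ContDiffOn.norm_sq ℝ (((hu.partialDeriv hU i).partialDeriv hU i).partialDeriv hU i)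
  have hPc : ContinuousOn (fun s => ∑ i : Fin 3, ∫ x, ‖((partialDeriv i)^[3] (u s)) x‖ ^ 2)
      (Ici (0 : ℝ)) :=
    continuousOn_finsetSum _ fun i _ => (hPj i).continuousOn_integral hSc
  -- the `H²` balance on `[t, t+1]`, integrated
  have h' : IsClassicalNSSolutionOn (Icc t (t + 1)) ν (fun _ => F) u p :=
    h.mono hS (uniqueDiffOn_Icc ht1)
  have hLI : ∫ s in t..t + 1, gradNormSq (laplacian (u s)) ≤
      2 / ν * (M₂ / 2 + (max C₀ 0 * (1 + M₂) ^ 2 + 2⁻¹ * (∫ x, ‖laplacian F x‖ ^ 2) +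
        2⁻¹ * M₂)) := by
    refine windowP3_integral_le_of_balance (E := fun s => 2⁻¹ * ∫ x, ‖laplacian (u s) x‖ ^ 2)
      (L := fun s => gradNormSq (laplacian (u s)))
      (I := fun s => ∫ x, ⟪convect (u s) (u s) x - F x, laplacian (laplacian (u s)) x⟫_ℝ) hν
      (fun s hs => h'.hasDerivWithinAt_half_integral_norm_sq_laplacian_iterate ht1 1 hs)
      ((hLc.mono hS).intervalIntegrable_of_Icc ht1.le)
      ((hIc.mono hS).intervalIntegrable_of_Icc ht1.le) (fun s hs => ?_)
      (mul_nonneg (by norm_num) (integral_nonneg fun _ => sq_nonneg _)) ?_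
    · -- `−I(s) ≤ (ν/2) L(s) + b`
      have hs0 : s ∈ Ici (0 : ℝ) := hS hs
      have hus : IsSmooth (u s) := hu.isSmooth_slice hs0
      have hΔΔ : IsSmooth (laplacian (laplacian (u s))) := hus.laplacian.laplacian
      have hconv : IsSmooth (convect (u s) (u s)) := hus.convect hus
      have hsplit : (∫ x, ⟪convect (u s) (u s) x - F x, laplacian (laplacian (u s)) x⟫_ℝ) =
          (∫ x, ⟪convect (u s) (u s) x, laplacian (laplacian (u s)) x⟫_ℝ) -
            ∫ x, ⟪F x, laplacian (laplacian (u s)) x⟫_ℝ := by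
        simp only [inner_sub_left]
        exact integral_sub (hconv.inner hΔΔ).integrable (hF.inner hΔΔ).integrable
      have hN := (neg_le_abs _).trans (hC₀ (u s) hus (h.divFree s hs0) (hzm s hs0) (hM s hs0))
      have hL2s : ∫ x, ‖laplacian (u s) x‖ ^ 2 ≤ M₂ := hM₂ s (ht.trans hs.1)
      have hL20 : 0 ≤ ∫ x, ‖laplacian (u s) x‖ ^ 2 := integral_nonneg fun _ => sq_nonneg _
      have hCC : C₀ * (1 + ∫ x, ‖laplacian (u s) x‖ ^ 2) ^ 2 ≤ max C₀ 0 * (1 + M₂) ^ 2 :=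
        calc C₀ * (1 + ∫ x, ‖laplacian (u s) x‖ ^ 2) ^ 2
            ≤ max C₀ 0 * (1 + ∫ x, ‖laplacian (u s) x‖ ^ 2) ^ 2 :=
              mul_le_mul_of_nonneg_right (le_max_left _ _) (sq_nonneg _)
          _ ≤ max C₀ 0 * (1 + M₂) ^ 2 :=
              mul_le_mul_of_nonneg_left
                (pow_le_pow_left₀ (by linarith) (by linarith) 2) (le_max_right _ _)
      have hP := windowP3_integral_inner_laplacian_laplacian_le hF hus
      beta_reduce
      rw [hsplit]
      linarith
    · -- `E(t) ≤ M₂/2`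
      have hEt := hM₂ t ht
      linarith
  -- `Σᵢ ∫‖∂ᵢ³u(s)‖² ≤ gradNormSq (Δu(s))` pointwise, and monotonicity of the window integral
  calc ∫ s in t..t + 1, (∑ i : Fin 3, ∫ x, ‖((partialDeriv i)^[3] (u s)) x‖ ^ 2)
      ≤ ∫ s in t..t + 1, gradNormSq (laplacian (u s)) :=
        intervalIntegral.integral_mono_on ht1.le ((hPc.mono hS).intervalIntegrable_of_Icc ht1.le)
          ((hLc.mono hS).intervalIntegrable_of_Icc ht1.le)
          fun s hs => windowP3_sum_integral_iterate_three_le (hu.isSmooth_slice (hS hs))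
    _ ≤ _ := hLI

end Summit.AnomalousDissipation.AnomalousDissipation.Theorems.ChainRealisation.SeparatrixFluxPinning

end
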